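import Literature.AlgebraicGeometry.Resolution.IdealIntegralClosure
import Mathlib.RingTheory.Valuation.LocalSubring
import Mathlib.RingTheory.Localization.FractionRing
import Mathlib.Algebra.Polynomial.Lifts
import Mathlib.Algebra.BigOperators.Field
import HarnessLib

/-!
# Integral dependence on the powers of an ideal is decided on the charts of the blow-up

Topic `Literature/AlgebraicGeometry/Resolution`. For a subring `R` of a field `K`, an ideal
`I = (f₁, …, f_s) ≠ 0` of `R`, `μ ≥ 0` and `g ∈ R`, PROVED here:

* `isIntegralOverIdeal_pow_iff_isIntegral_monomial` — **`g` is integral over `I^μ` iff `g·t^μ ∈ R[t]` is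
  integral over the Rees algebra `R[It]`** (any commutative ring; the degree-`μ` reading of Huneke–Swanson
  Prop. 5.2.1, extending the tree's degree-`1` lemma `isIntegralOverIdeal_iff_isIntegral_monomial`);
* `div_pow_mem_adjoin_div_of_mem_pow` — `c ∈ I^m ⇒ c/f^m ∈ R[I/f]`, the chart ring
  `R[I/f] = R[h/f : h ∈ I] ⊆ K` of the blow-up of `I` (Görtz–Wedhorn (13.19));
* `isIntegral_adjoin_div_of_isIntegralOverIdeal_pow` — the easy direction: `g` integral over `I^μ` ⇒ `g/f^μ` is
  integral over `R[I/f]` for every `f ≠ 0`;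
* `isIntegralOverIdeal_pow_of_forall_isIntegral_adjoin_div` — **the chart criterion**: if `g/fᵢ^μ` is integral
  over `R[I/fᵢ]` for every non-zero member `fᵢ` of a finite generating set of `I`, then `g` is integral over
  `I^μ`. Equivalently (`isIntegralOverIdeal_pow_iff_forall_isIntegral_adjoin_div`, and the variant
  `…_adjoin_div_finset` with the chart rings generated by the `h/fᵢ`, `h ∈ S` only): with `Bᵢ` the integral
  closure of `R[I/fᵢ]` in `K` — the affine rings of the normalized blow-up of `I` when `R` is a Noetherian
  domain — `\overline{I^μ} = R ∩ ⋂ᵢ fᵢ^μ Bᵢ`. This is Huneke–Swanson Thm. 10.2.2 (3) («In particular, for all n,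
  \overline{Iⁿ} = ⋂ᵢ aᵢⁿ S̄ᵢ ∩ R», Rees), there for Noetherian domains via Krull/Mori–Nagata; here for any domain,
  via the valuative criterion (Prop. 6.8.2 / Thm. 6.8.3). Cf. Hironaka 2005 [F5] p.95 l.37–42 «ρ_*(J₂𝒪_Z̃) is
  equal to the integral closure of J₂» for the normalized blowing-up `ρ`.

The proof of the chart criterion is valuative and needs neither Noetherianity nor finiteness of integral
closures: by Stacks 090P (Mathlib `Subring.exists_le_valuationSubring_of_isIntegrallyClosedIn`) it suffices
to see that `g t^μ` lies in every valuation ring `V` of `L = Frac(K[t])` containing `R[It]`; for such `V`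
pick a generator `f₀` with `v(f₀ t)` extremal, then `h/f₀ = (h t)/(f₀ t) ∈ V` for all `h ∈ I`, so
`R[I/f₀] ⊆ V`, so `g/f₀^μ ∈ V` (valuation rings are integrally closed), so `g t^μ = (f₀ t)^μ · g/f₀^μ ∈ V`.

Consumer (index only): the campaign `res-hironaka`, step S3 of the sizing of [24] §12 (♭)⊆
(`Hironaka2005.jmax_flat_of_le`, `Hironaka2005CalPOfFlat.lean`): membership of `g` in the charts
`f_i^μ B_i` of the normalized blow-up of `J♯` gives integral dependence of `g` on `(J♯)^μ`.

## Sources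
* C. Huneke, I. Swanson, *Integral Closure of Ideals, Rings, and Modules*, LMS LN 336 (2006), Prop. 5.2.1
  (integral closure of `R[It]` in `R[t]`), Prop. 5.5.8 (`R[I/aᵢ]` as the degree-zero part of `R[It]_{aᵢt}`),
  Prop. 6.8.2 / Thm. 6.8.3 (valuative criterion), Thm. 10.2.2 (3) («\overline{Iⁿ} = ⋂ᵢ aᵢⁿ S̄ᵢ ∩ R»).
  [HunekeSwanson2006]
* The Stacks Project, Tag 090P (integrally closed subrings are intersections of valuation rings), Tag 052Q
  (affine blowup algebra `R[I/a]`). [StacksProject]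
* U. Görtz, T. Wedhorn, *Algebraic Geometry I*, 2nd ed. (2020), (13.19) p.415. [GortzWedhorn2020]
* H. Hironaka, Sémin. Congr. 10 (2005), [F5] p.95 l.32–42. [Hironaka2005]
-/

noncomputable section

open Polynomial

universe u v

namespace Literature.AlgebraicGeometry.Resolution

namespace Hironaka2005

/-! ## §1 Integral dependence on `I^μ` = integrality of `g t^μ` over the Rees algebra -/

section Rees

variable {R : Type u} [CommRing R]

/-- Normalisation of an equation of integral dependence: the coefficients may be taken in `Iʲ` for ALL `j`
(zero outside `1 ≤ j ≤ N`). (Plumbing.) [folklore] -/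
private theorem IsIntegralOverIdeal.exists_normalised' {I : Ideal R} {x : R} (hx : IsIntegralOverIdeal I x) :
    ∃ (N : ℕ) (c : ℕ → R), 0 < N ∧ (∀ j, c j ∈ I ^ j) ∧
      x ^ N + ∑ j ∈ Finset.Icc 1 N, c j * x ^ (N - j) = 0 := by
  classical
  obtain ⟨N, c, hN, hc, heq⟩ := hx
  refine ⟨N, fun j => if j ∈ Finset.Icc 1 N then c j else 0, hN, fun j => ?_, ?_⟩
  · dsimp only
    by_cases hj : j ∈ Finset.Icc 1 N
    · rw [if_pos hj]; exact hc j hj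
    · rw [if_neg hj]; exact Ideal.zero_mem _
  · have hs : ∑ j ∈ Finset.Icc 1 N, (if j ∈ Finset.Icc 1 N then c j else 0) * x ^ (N - j) =
        ∑ j ∈ Finset.Icc 1 N, c j * x ^ (N - j) :=
      Finset.sum_congr rfl fun j hj => by rw [if_pos hj]
    rw [hs]
    exact heq

/-- **`g` is integral over `I^μ` iff `g·t^μ` is integral over the Rees algebra `R[It]`**: an equation
`gᴺ + Σ c_j g^{N−j} = 0`, `c_j ∈ I^{μj}`, is the `t^{μN}`-coefficient of a monic equation for `g t^μ` over
`⊕ Iⁿtⁿ`, and conversely `Tᴺ + Σ (c_j t^{μj}) T^{N−j}` is such an equation (Huneke–Swanson Prop. 5.2.1, stated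
there for degree `1`; [24] [F5] p.95 l.35–37). [cite: HunekeSwanson2006, Prop. 5.2.1] -/
theorem isIntegralOverIdeal_pow_iff_isIntegral_monomial (I : Ideal R) (μ : ℕ) (x : R) :
    IsIntegralOverIdeal (I ^ μ) x ↔ IsIntegral (reesAlgebra I) (monomial μ x : R[X]) := by
  classical
  constructor
  · intro hx
    obtain ⟨N, c, hN, hc, heq⟩ := hx.exists_normalised'
    have hc' : ∀ j, c j ∈ I ^ (μ * j) := fun j => by rw [pow_mul]; exact hc j
    -- the monic polynomial `T^N + Σ (c_j t^{μj}) T^{N-j}` over the Rees algebra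
    let a : ℕ → reesAlgebra I := fun j => ⟨monomial (μ * j) (c j), reesAlgebra.monomial_mem.mpr (hc' j)⟩
    let q : (reesAlgebra I)[X] := ∑ j ∈ Finset.Icc 1 N, C (a j) * X ^ (N - j)
    have hq : q.degree < N := by
      refine lt_of_le_of_lt (Polynomial.degree_sum_le _ _) ?_
      refine (Finset.sup_lt_iff (WithBot.bot_lt_coe N)).mpr fun j hj => ?_
      refine lt_of_le_of_lt (Polynomial.degree_C_mul_X_pow_le _ _) ?_
      have hj1 : 1 ≤ j := (Finset.mem_Icc.mp hj).1
      have : N - j < N := by omega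
      exact WithBot.coe_lt_coe.mpr this
    refine ⟨X ^ N + q, monic_X_pow_add hq, ?_⟩
    have heval : eval₂ (algebraMap (reesAlgebra I) R[X]) (monomial μ x) (X ^ N + q) =
        monomial (μ * N) (x ^ N + ∑ j ∈ Finset.Icc 1 N, c j * x ^ (N - j)) := by
      have ha : ∀ j, algebraMap (reesAlgebra I) R[X] (a j) = monomial (μ * j) (c j) := fun j => rfl
      simp only [q, eval₂_add, eval₂_pow, eval₂_X, eval₂_finsetSum, eval₂_mul, eval₂_C, ha]
      rw [map_add, map_sum, monomial_pow]
      congr 1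
      refine Finset.sum_congr rfl fun j hj => ?_
      have hjN : j ≤ N := (Finset.mem_Icc.mp hj).2
      rw [monomial_pow, monomial_mul_monomial,
        show μ * j + μ * (N - j) = μ * N by rw [← Nat.mul_add, Nat.add_sub_cancel' hjN]]
    rw [heval, heq, map_zero]
  · rintro ⟨p, hmon, hp⟩
    -- degenerate case: `R` trivial
    rcases subsingleton_or_nontrivial R with hR | hR
    · exact ⟨1, fun _ => 0, Nat.one_pos, fun _ _ => Ideal.zero_mem _, Subsingleton.elim _ _⟩
    set N := p.natDegree with hN
    have hN0 : 0 < N := by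
      by_contra h0
      have hN0' : p.natDegree = 0 := by omega
      rw [Polynomial.Monic.natDegree_eq_zero hmon] at hN0'
      rw [hN0', eval₂_one] at hp
      exact one_ne_zero hp
    -- the coefficient of `t^{μN}` in `p(x t^μ) = 0`
    have hsum : ∑ i ∈ Finset.range (N + 1),
        ((p.coeff i : reesAlgebra I) : R[X]).coeff (μ * (N - i)) * x ^ i = 0 := by
      have h := congrArg (fun f : R[X] => f.coeff (μ * N)) hp
      simp only [coeff_zero] at h
      rw [eval₂_eq_sum_range, finsetSum_coeff] at h
      rw [← h]
      refine Finset.sum_congr rfl fun i hi => ?_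
      have hiN : i ≤ N := Nat.lt_succ_iff.mp (Finset.mem_range.mp hi)
      rw [monomial_pow,
        show μ * N = μ * (N - i) + μ * i by rw [← Nat.mul_add, Nat.sub_add_cancel hiN], coeff_mul_monomial]
      rfl
    refine ⟨N, fun j => ((p.coeff (N - j) : reesAlgebra I) : R[X]).coeff (μ * j), hN0, fun j _ => ?_, ?_⟩
    · rw [← pow_mul]
      exact (mem_reesAlgebra_iff I _).mp (p.coeff (N - j)).2 (μ * j)
    · -- reindex `i = N - j`
      rw [Finset.sum_range_succ, hmon.coeff_natDegree] at hsum
      have h1 : (((1 : reesAlgebra I) : R[X])).coeff (μ * (N - N)) = 1 := by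
        rw [Nat.sub_self, Nat.mul_zero]; exact coeff_one_zero
      rw [h1, one_mul] at hsum
      rw [add_comm] at hsum
      rw [← hsum]
      congr 1
      rw [show Finset.Icc 1 N = Finset.Ico 1 (N + 1) from rfl, Finset.sum_Ico_eq_sum_range,
        show N + 1 - 1 = N by omega, ← Finset.sum_range_reflect _ N]
      refine Finset.sum_congr rfl fun i hi => ?_
      have hi' : i < N := Finset.mem_range.mp hi
      simp only []
      rw [show N - (1 + (N - 1 - i)) = i by omega, show 1 + (N - 1 - i) = N - i by omega]

end Rees

/-! ## §2 The chart rings `R[I/f] ⊆ K` and the easy direction -/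

section Charts

variable {R : Type u} [CommRing R] {K : Type v} [Field K] [Algebra R K]

/-- `c ∈ I^m ⇒ c/f^m ∈ R[I/f] = R[h/f : h ∈ I]` (a product of `m` elements of `I` divided by `f^m` is the
product of the `hᵢ/f`; Görtz–Wedhorn (13.19) p.415, Stacks 052Q «x/aⁿ with x ∈ Iⁿ»).
[cite: GortzWedhorn2020, (13.19) p.415] -/
theorem div_pow_mem_adjoin_div_of_mem_pow (I : Ideal R) (f : R) :
    ∀ (m : ℕ) {c : R}, c ∈ I ^ m →
      algebraMap R K c / algebraMap R K f ^ m ∈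
        Algebra.adjoin R ((fun h : R => algebraMap R K h / algebraMap R K f) '' (I : Set R)) := by
  intro m
  induction m with
  | zero =>
    intro c _
    rw [pow_zero, div_one]
    exact Subalgebra.algebraMap_mem _ c
  | succ m ih =>
    intro c hc
    rw [pow_succ] at hc
    refine Submodule.mul_induction_on hc (fun a ha b hb => ?_) (fun y z hy hz => ?_)
    · rw [map_mul, pow_succ, ← div_mul_div_comm]
      exact Subalgebra.mul_mem _ (ih ha) (Algebra.subset_adjoin ⟨b, hb, rfl⟩)
    · rw [map_add, add_div]
      exact Subalgebra.add_mem _ hy hz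

/-- The chart ring is generated by the `h/f` for `h` in any generating set of the ideal:
`R[h/f : h ∈ S] = R[h/f : h ∈ (S)]` (`(Σ aᵢ sᵢ)/f = Σ aᵢ (sᵢ/f)`). [cite: GortzWedhorn2020, (13.19) p.415] -/
theorem adjoin_div_image_span (S : Set R) (f : R) :
    Algebra.adjoin R ((fun h : R => algebraMap R K h / algebraMap R K f) '' S) =
      Algebra.adjoin R ((fun h : R => algebraMap R K h / algebraMap R K f) '' (Ideal.span S : Set R)) := by
  apply le_antisymm
  · exact Algebra.adjoin_mono (Set.image_mono Ideal.subset_span)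
  · refine Algebra.adjoin_le ?_
    rintro _ ⟨h, hh, rfl⟩
    refine Submodule.span_induction
      (p := fun y _ => algebraMap R K y / algebraMap R K f ∈
        Algebra.adjoin R ((fun h : R => algebraMap R K h / algebraMap R K f) '' S)) ?_ ?_ ?_ ?_ hh
    · intro s hs
      exact Algebra.subset_adjoin ⟨s, hs, rfl⟩
    · rw [map_zero, zero_div]
      exact Subalgebra.zero_mem _
    · intro y z _ _ hy hz
      rw [map_add, add_div]
      exact Subalgebra.add_mem _ hy hz
    · intro r y _ hy
      rw [smul_eq_mul, map_mul, mul_div_assoc]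
      exact Subalgebra.mul_mem _ (Subalgebra.algebraMap_mem _ r) hy

/-- Integrality over a subalgebra persists over any larger subalgebra. (Plumbing.) [folklore] -/
private theorem isIntegral_of_subalgebra_le {A B : Subalgebra R K} (hAB : A ≤ B) {x : K} (hx : IsIntegral A x) :
    IsIntegral B x := by
  obtain ⟨p, hp, hpx⟩ := hx
  refine ⟨p.map (Subalgebra.inclusion hAB).toRingHom, hp.map _, ?_⟩
  rw [eval₂_map]
  have hcomp : (algebraMap B K).comp (Subalgebra.inclusion hAB).toRingHom = algebraMap A K :=
    RingHom.ext fun _ => rfl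
  rw [hcomp]
  exact hpx

/-- **The easy direction**: if `g` is integral over `I^μ`, `gᴺ + Σ c_j g^{N−j} = 0` with `c_j ∈ I^{μj}`, then
dividing by `f^{μN}` exhibits `g/f^μ` as integral over the chart ring `R[I/f]` (`c_j/f^{μj} ∈ R[I/f]`), for
every `f ∈ R` non-zero in `K` (the inclusion `⊆` of Huneke–Swanson Thm. 10.2.2 (3)). [cite: HunekeSwanson2006, Thm. 10.2.2 (3)] -/
theorem isIntegral_adjoin_div_of_isIntegralOverIdeal_pow (I : Ideal R) {μ : ℕ} {g f : R}
    (hf : algebraMap R K f ≠ 0) (hg : IsIntegralOverIdeal (I ^ μ) g) :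
    IsIntegral (Algebra.adjoin R ((fun h : R => algebraMap R K h / algebraMap R K f) '' (I : Set R)))
      (algebraMap R K g / algebraMap R K f ^ μ) := by
  classical
  set T := Algebra.adjoin R ((fun h : R => algebraMap R K h / algebraMap R K f) '' (I : Set R)) with hT
  obtain ⟨N, c, hN, hc, heq⟩ := hg.exists_normalised'
  have hc' : ∀ j, c j ∈ I ^ (μ * j) := fun j => by rw [pow_mul]; exact hc j
  let φ := algebraMap R K
  -- the coefficients `c_j / f^{μj} ∈ R[I/f]`
  let a : ℕ → T := fun j => ⟨φ (c j) / φ f ^ (μ * j), div_pow_mem_adjoin_div_of_mem_pow I f (μ * j) (hc' j)⟩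
  let q : T[X] := ∑ j ∈ Finset.Icc 1 N, C (a j) * X ^ (N - j)
  have hq : q.degree < N := by
    refine lt_of_le_of_lt (Polynomial.degree_sum_le _ _) ?_
    refine (Finset.sup_lt_iff (WithBot.bot_lt_coe N)).mpr fun j hj => ?_
    refine lt_of_le_of_lt (Polynomial.degree_C_mul_X_pow_le _ _) ?_
    have hj1 : 1 ≤ j := (Finset.mem_Icc.mp hj).1
    have : N - j < N := by omega
    exact WithBot.coe_lt_coe.mpr this
  refine ⟨X ^ N + q, monic_X_pow_add hq, ?_⟩
  have ha : ∀ j, algebraMap T K (a j) = φ (c j) / φ f ^ (μ * j) := fun j => rfl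
  have hfpow : ∀ n : ℕ, φ f ^ n ≠ 0 := fun n => pow_ne_zero n hf
  -- each term equals `φ(c_j g^{N-j}) / φ(f)^{μN}`
  have hterm : ∀ j ∈ Finset.Icc 1 N,
      φ (c j) / φ f ^ (μ * j) * (φ g / φ f ^ μ) ^ (N - j) = φ (c j * g ^ (N - j)) / φ f ^ (μ * N) := by
    intro j hj
    have hjN : j ≤ N := (Finset.mem_Icc.mp hj).2
    rw [div_pow, ← pow_mul, div_mul_div_comm, ← pow_add, map_mul, map_pow,
      show μ * j + μ * (N - j) = μ * N by rw [← Nat.mul_add, Nat.add_sub_cancel' hjN]]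
  have hlead : (φ g / φ f ^ μ) ^ N = φ (g ^ N) / φ f ^ (μ * N) := by
    rw [div_pow, ← pow_mul, map_pow]
  simp only [q, eval₂_add, eval₂_pow, eval₂_X, eval₂_finsetSum, eval₂_mul, eval₂_C, ha]
  rw [hlead, Finset.sum_congr rfl hterm, ← Finset.sum_div, ← add_div, ← map_sum, ← map_add, heq, map_zero,
    zero_div]

end Charts

/-! ## §3 The chart criterion (valuative proof) -/

section Criterion

variable {R : Type u} [CommRing R] {K : Type v} [Field K] [Algebra R K]

/-- Valuation rings are integrally closed: an element of `L` integral over an `R`-subalgebra `T ⊆ K` that is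
mapped into the valuation ring `V ⊆ L` lies in `V`. (Plumbing.) [folklore] -/
private theorem mem_valuationSubring_of_isIntegral_of_map_mem {L : Type*} [Field L] (θ : K →+* L)
    (V : ValuationSubring L) (T : Subalgebra R K) (hT : ∀ t ∈ T, θ t ∈ V) {β : K} (hβ : IsIntegral T β) :
    θ β ∈ V := by
  let θT : T →+* V :=
    { toFun := fun t => ⟨θ t, hT t t.2⟩
      map_one' := Subtype.ext (by simp)
      map_mul' := fun a b => Subtype.ext (by simp)
      map_zero' := Subtype.ext (by simp)
      map_add' := fun a b => Subtype.ext (by simp) }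
  have hx' : IsIntegral V (θ β) := by
    obtain ⟨p, hp, hpx⟩ := hβ
    refine ⟨p.map θT, hp.map θT, ?_⟩
    rw [Polynomial.eval₂_map]
    have hcomp : (algebraMap V L).comp θT = θ.comp (algebraMap T K) := RingHom.ext fun a => rfl
    rw [hcomp, ← Polynomial.hom_eval₂, hpx, map_zero]
  obtain ⟨y, hy⟩ := IsIntegrallyClosed.algebraMap_eq_of_integral hx'
  rw [← hy]
  exact y.2

/-- **Chart criterion for integral dependence on the powers of an ideal.** Let `R ⊆ K` (`K` a field),
`I = (S)` with `S` finite and `I ≠ 0`, `μ ≥ 0`, `g ∈ R`. If for every non-zero `f ∈ S` the element `g/f^μ`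
of `K` is integral over the chart ring `R[I/f] = R[h/f : h ∈ I]`, then `g` is integral over `I^μ`
(i.e. `g ∈ R ∩ ⋂ f^μ·\overline{R[I/f]} ⇒ g ∈ \overline{I^μ}`: the inclusion `⊇` of Huneke–Swanson Thm. 10.2.2 (3)
«\overline{Iⁿ} = ⋂ᵢ aᵢⁿ S̄ᵢ ∩ R», `Sᵢ = R[I/aᵢ]`). Valuative proof via Stacks 090P (cf. Prop. 6.8.2 / Thm. 6.8.3),
no Noetherian hypothesis. [cite: HunekeSwanson2006, Thm. 10.2.2 (3)] -/
theorem isIntegralOverIdeal_pow_of_forall_isIntegral_adjoin_div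
    (hinj : Function.Injective (algebraMap R K)) {I : Ideal R} (S : Finset R)
    (hS : Ideal.span (S : Set R) = I) (hI : I ≠ ⊥) (μ : ℕ) (g : R)
    (h : ∀ f ∈ S, f ≠ 0 →
      IsIntegral (Algebra.adjoin R ((fun h : R => algebraMap R K h / algebraMap R K f) '' (I : Set R)))
        (algebraMap R K g / algebraMap R K f ^ μ)) :
    IsIntegralOverIdeal (I ^ μ) g := by
  classical
  -- notation: `φ : R → K`, `L = Frac(K[t])`, `ψ : R[t] → L`, `θ : K → L`
  let φ : R →+* K := algebraMap R K
  let L := FractionRing K[X]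
  let ιL : K[X] →+* L := algebraMap K[X] L
  let ψ : R[X] →+* L := ιL.comp (mapRingHom φ)
  let θ : K →+* L := ιL.comp C
  have hιL : Function.Injective ιL := IsFractionRing.injective K[X] L
  have hψ : Function.Injective ψ := hιL.comp (map_injective φ hinj)
  have hψC : ∀ r : R, ψ (C r) = θ (φ r) := fun r => by
    simp only [ψ, θ, RingHom.comp_apply, coe_mapRingHom, map_C]
  have hψmon : ∀ (n : ℕ) (r : R), ψ (monomial n r) = θ (φ r) * ιL X ^ n := fun n r => by
    simp only [ψ, θ, RingHom.comp_apply, coe_mapRingHom, ← C_mul_X_pow_eq_monomial, map_mul, map_pow,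
      Polynomial.map_C, Polynomial.map_X]
  have hXL : ιL X ≠ 0 := fun h0 => X_ne_zero (hιL (by rw [h0, map_zero]))
  -- the Rees algebra inside `L` and its integral closure
  let ρ : reesAlgebra I →+* L := ψ.comp (algebraMap (reesAlgebra I) R[X])
  let Ree : Subring L := ρ.range
  let Cl : Subring L := (integralClosure Ree L).toSubring
  have hReeCl : Ree ≤ Cl := fun y hy => by
    change IsIntegral Ree y
    exact isIntegral_algebraMap (x := (⟨y, hy⟩ : Ree))
  have hmonRee : ∀ {n : ℕ} {r : R}, r ∈ I ^ n → ψ (monomial n r) ∈ Ree := fun {n r} hr =>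
    ⟨⟨monomial n r, reesAlgebra.monomial_mem.mpr hr⟩, rfl⟩
  have hCRee : ∀ r : R, ψ (C r) ∈ Ree := fun r => by
    rw [← monomial_zero_left]; exact hmonRee (by rw [pow_zero, Ideal.one_eq_top]; exact Submodule.mem_top)
  -- the element `x = g t^μ`
  let x : L := ψ (monomial μ g)
  -- MAIN CLAIM: `x` lies in the integral closure of the Rees algebra (valuative criterion, Stacks 090P)
  have hxCl : x ∈ Cl := by
    by_contra hxCl
    obtain ⟨V, hClV, hxV⟩ := Subring.exists_le_valuationSubring_of_isIntegrallyClosedIn hxCl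
    have hReeV : ∀ y ∈ Ree, y ∈ V := fun y hy => hClV (hReeCl hy)
    apply hxV
    -- a non-zero generator and a generator `f₀` of maximal valuation
    have hSne : ∃ f ∈ S, f ≠ 0 := by
      by_contra hall
      apply hI
      rw [← hS, Ideal.span_eq_bot]
      intro f hf
      by_contra hf0
      exact hall ⟨f, hf, hf0⟩
    obtain ⟨f₁, hf₁S, hf₁⟩ := hSne
    obtain ⟨f₀, hf₀S, hmax⟩ :=
      S.exists_max_image (fun f => V.valuation (ψ (monomial 1 f))) ⟨f₁, hf₁S⟩
    have hfI : ∀ f ∈ S, f ∈ I := fun f hf => by rw [← hS]; exact Ideal.subset_span hf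
    have hv₁ : V.valuation (ψ (monomial 1 f₁)) ≠ 0 := by
      rw [Ne, Valuation.zero_iff]
      intro h0
      exact hf₁ ((monomial_eq_zero_iff _ _).mp (hψ (by rw [h0, map_zero])))
    have hv₀ : V.valuation (ψ (monomial 1 f₀)) ≠ 0 := by
      intro h0
      have := hmax f₁ hf₁S
      rw [h0, le_zero_iff] at this
      exact hv₁ this
    have hψf₀ : ψ (monomial 1 f₀) ≠ 0 := fun h0 => hv₀ (by rw [h0, map_zero])
    have hf₀ : f₀ ≠ 0 := fun h0 => hψf₀ (by rw [h0, map_zero, map_zero])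
    have hφf₀ : φ f₀ ≠ 0 := fun h0 => hf₀ (hinj (by rw [h0, map_zero]))
    have hθf₀ : θ (φ f₀) ≠ 0 := fun h0 => hφf₀ (by
      have := (injective_iff_map_eq_zero θ).mp θ.injective _ h0
      exact this)
    -- every `h/f₀`, `h ∈ I`, lies in `V`
    have hgen : ∀ hh ∈ I, θ (φ hh / φ f₀) ∈ V := by
      intro hh hhI
      rw [← hS] at hhI
      refine Submodule.span_induction (p := fun y _ => θ (φ y / φ f₀) ∈ V) ?_ ?_ ?_ ?_ hhI
      · intro s hs
        have hle : V.valuation (ψ (monomial 1 s)) ≤ V.valuation (ψ (monomial 1 f₀)) := hmax s hs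
        have hq : θ (φ s / φ f₀) = ψ (monomial 1 s) / ψ (monomial 1 f₀) := by
          rw [map_div₀, hψmon, hψmon, pow_one, mul_div_mul_right _ _ hXL]
        rw [hq, ← V.valuation_le_one_iff, map_div₀]
        exact div_le_one_of_le₀ hle zero_le
      · rw [map_zero, zero_div, map_zero]; exact V.zero_mem
      · intro y z _ _ hy hz
        rw [map_add, add_div, map_add]; exact V.add_mem _ _ hy hz
      · intro r y _ hy
        rw [smul_eq_mul, map_mul, mul_div_assoc, map_mul, ← hψC]
        exact V.mul_mem _ _ (hReeV _ (hCRee r)) hy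
    -- hence the chart ring `R[I/f₀]` maps into `V`
    let W : Subalgebra R K :=
      { carrier := {y | θ y ∈ V}
        mul_mem' := fun {a b} ha hb => by
          simp only [Set.mem_setOf_eq, map_mul]; exact V.mul_mem _ _ ha hb
        one_mem' := by simp only [Set.mem_setOf_eq, map_one]; exact V.one_mem
        add_mem' := fun {a b} ha hb => by
          simp only [Set.mem_setOf_eq, map_add]; exact V.add_mem _ _ ha hb
        zero_mem' := by simp only [Set.mem_setOf_eq, map_zero]; exact V.zero_mem
        algebraMap_mem' := fun r => by
          simp only [Set.mem_setOf_eq]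
          rw [show algebraMap R K r = φ r from rfl, ← hψC]
          exact hReeV _ (hCRee r) }
    have hTW : Algebra.adjoin R ((fun hh : R => φ hh / φ f₀) '' (I : Set R)) ≤ W := by
      refine Algebra.adjoin_le ?_
      rintro _ ⟨hh, hhI, rfl⟩
      exact hgen hh hhI
    -- so `g/f₀^μ ∈ V`, and `x = (f₀ t)^μ · (g/f₀^μ) ∈ V`
    have hβ : θ (φ g / φ f₀ ^ μ) ∈ V :=
      mem_valuationSubring_of_isIntegral_of_map_mem θ V _ (fun t ht => hTW ht) (h f₀ hf₀S hf₀)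
    have hx : x = ψ (monomial 1 f₀) ^ μ * θ (φ g / φ f₀ ^ μ) := by
      simp only [x]
      rw [hψmon, hψmon, pow_one, map_div₀, map_pow, mul_pow, mul_right_comm,
        mul_div_cancel₀ _ (pow_ne_zero μ hθf₀)]
    rw [hx]
    exact V.mul_mem _ _ (V.pow_mem (hReeV _ (hmonRee (by rw [pow_one]; exact hfI f₀ hf₀S))) μ) hβ
  -- from the claim: `g t^μ` is integral over the Rees algebra, inside `R[t]`
  have hxint : IsIntegral Ree x := hxCl
  obtain ⟨p, hpmon, hpx⟩ := hxint
  obtain ⟨q, hqp, -, hqmon⟩ :=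
    lifts_and_natDegree_eq_and_monic ((mem_lifts _).mpr (map_surjective _ ρ.rangeRestrict_surjective p))
      hpmon
  have hq0 : eval₂ (algebraMap (reesAlgebra I) R[X]) (monomial μ g) q = 0 := by
    apply hψ
    rw [map_zero, hom_eval₂]
    have hcomp : ψ.comp (algebraMap (reesAlgebra I) R[X]) = (algebraMap Ree L).comp ρ.rangeRestrict :=
      RingHom.ext fun _ => rfl
    rw [hcomp, ← eval₂_map, hqp]
    exact hpx
  exact (isIntegralOverIdeal_pow_iff_isIntegral_monomial I μ g).mpr ⟨q, hqmon, hq0⟩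

/-- **`\overline{I^μ} = R ∩ ⋂ᵢ fᵢ^μ · \overline{R[I/fᵢ]}`**, elementwise: for `I = (S) ≠ 0`, `S` finite, `g ∈ R` is
integral over `I^μ` iff `g/f^μ` is integral over `R[I/f]` for every non-zero `f ∈ S` (the charts of the
normalized blow-up of `I` compute the integral closures of its powers; Huneke–Swanson Thm. 10.2.2 (3), for any
domain; Hironaka 2005 [F5] p.95 l.37–42). [cite: HunekeSwanson2006, Thm. 10.2.2 (3)] -/
theorem isIntegralOverIdeal_pow_iff_forall_isIntegral_adjoin_div
    (hinj : Function.Injective (algebraMap R K)) {I : Ideal R} (S : Finset R)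
    (hS : Ideal.span (S : Set R) = I) (hI : I ≠ ⊥) (μ : ℕ) (g : R) :
    IsIntegralOverIdeal (I ^ μ) g ↔ ∀ f ∈ S, f ≠ 0 →
      IsIntegral (Algebra.adjoin R ((fun h : R => algebraMap R K h / algebraMap R K f) '' (I : Set R)))
        (algebraMap R K g / algebraMap R K f ^ μ) :=
  ⟨fun hg f _ hf => isIntegral_adjoin_div_of_isIntegralOverIdeal_pow I
      (fun h0 => hf (hinj (by rw [h0, map_zero]))) hg,
    isIntegralOverIdeal_pow_of_forall_isIntegral_adjoin_div hinj S hS hI μ g⟩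

/-- **Chart criterion, charts over the generators**: the same with the chart rings `R[h/f : h ∈ S]` generated by
the finitely many `h/f`, `h ∈ S` (equal to `R[I/f]` by `adjoin_div_image_span`; these are the rings
`Sᵢ = R[I/aᵢ]` of Huneke–Swanson Thm. 10.2.2 (3), of finite type over `R`). [cite: HunekeSwanson2006, Thm. 10.2.2 (3)] -/
theorem isIntegralOverIdeal_pow_iff_forall_isIntegral_adjoin_div_finset
    (hinj : Function.Injective (algebraMap R K)) {I : Ideal R} (S : Finset R)
    (hS : Ideal.span (S : Set R) = I) (hI : I ≠ ⊥) (μ : ℕ) (g : R) :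
    IsIntegralOverIdeal (I ^ μ) g ↔ ∀ f ∈ S, f ≠ 0 →
      IsIntegral (Algebra.adjoin R ((fun h : R => algebraMap R K h / algebraMap R K f) '' (S : Set R)))
        (algebraMap R K g / algebraMap R K f ^ μ) := by
  have heq : ∀ f : R, Algebra.adjoin R ((fun h : R => algebraMap R K h / algebraMap R K f) '' (S : Set R)) =
      Algebra.adjoin R ((fun h : R => algebraMap R K h / algebraMap R K f) '' (I : Set R)) := fun f => by
    rw [adjoin_div_image_span, hS]
  constructor
  · intro hg f hf hf0
    exact isIntegral_of_subalgebra_le (heq f).ge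
      (isIntegral_adjoin_div_of_isIntegralOverIdeal_pow I (fun h0 => hf0 (hinj (by rw [h0, map_zero]))) hg)
  · intro h
    exact isIntegralOverIdeal_pow_of_forall_isIntegral_adjoin_div hinj S hS hI μ g fun f hf hf0 =>
      isIntegral_of_subalgebra_le (heq f).le (h f hf hf0)

/-- **Chart criterion for a finite family of generators** `I = (f₁, …, f_s)` (the indexing of Huneke–Swanson
Thm. 10.2.2 (3), `I = (a₁, …, a_d)`, `Sᵢ = R[I/aᵢ]`): if `g/fᵢ^μ` is integral over `R[I/fᵢ]` for every `i` with
`fᵢ ≠ 0`, then `g` is integral over `I^μ`. [cite: HunekeSwanson2006, Thm. 10.2.2 (3)] -/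
theorem isIntegralOverIdeal_pow_of_forall_chart
    (hinj : Function.Injective (algebraMap R K)) {I : Ideal R} {ι : Type*} [Fintype ι] (f : ι → R)
    (hf : Ideal.span (Set.range f) = I) (hI : I ≠ ⊥) (μ : ℕ) (g : R)
    (h : ∀ i, f i ≠ 0 →
      IsIntegral (Algebra.adjoin R ((fun h : R => algebraMap R K h / algebraMap R K (f i)) '' (I : Set R)))
        (algebraMap R K g / algebraMap R K (f i) ^ μ)) :
    IsIntegralOverIdeal (I ^ μ) g := by
  classical
  refine isIntegralOverIdeal_pow_of_forall_isIntegral_adjoin_div hinj (Finset.univ.image f) ?_ hI μ g ?_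
  · rw [Finset.coe_image, Finset.coe_univ, Set.image_univ]
    exact hf
  · intro f' hf' hf'0
    obtain ⟨i, -, rfl⟩ := Finset.mem_image.mp hf'
    exact h i hf'0

/-- The family version as an equivalence: `\overline{I^μ} = R ∩ ⋂ᵢ fᵢ^μ \overline{R[I/fᵢ]}` over the non-zero
members of a finite generating family. [cite: HunekeSwanson2006, Thm. 10.2.2 (3)] -/
theorem isIntegralOverIdeal_pow_iff_forall_chart
    (hinj : Function.Injective (algebraMap R K)) {I : Ideal R} {ι : Type*} [Fintype ι] (f : ι → R)
    (hf : Ideal.span (Set.range f) = I) (hI : I ≠ ⊥) (μ : ℕ) (g : R) :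
    IsIntegralOverIdeal (I ^ μ) g ↔ ∀ i, f i ≠ 0 →
      IsIntegral (Algebra.adjoin R ((fun h : R => algebraMap R K h / algebraMap R K (f i)) '' (I : Set R)))
        (algebraMap R K g / algebraMap R K (f i) ^ μ) :=
  ⟨fun hg i hi => isIntegral_adjoin_div_of_isIntegralOverIdeal_pow I
      (fun h0 => hi (hinj (by rw [h0, map_zero]))) hg,
    isIntegralOverIdeal_pow_of_forall_chart hinj f hf hI μ g⟩

end Criterion

end Hironaka2005

end Literature.AlgebraicGeometry.Resolution

end
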